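import Summits.Ventures.GridStability.Models.GFMSMIBTwinCCTUpper
import Summits.Ventures.GridStability.Models.InverterDroopVIQoriaP08

/-!
# GridStability/Models/GFMSMIBTwinVICCT — the twin «GFM-SMIB-QoriaV5s» WITH ITS VIRTUAL IMPEDANCE after clearing: a certified clearing-time bracket `0.44 s ≤ CCT(M_twin+VI) ≤ 0.58 s` against the PRINTED `t_c = 498 ms` (Qoria 2020 §V.3.6, `H_VSC = 5 s`, VI active) — the cell's first like-for-like comparator for a grid-forming converter with inertial effect AND current limitation

Cell `gridfusion` (LADDER-GRIDFUSION rung G3.a, thread «G3.a-cct»; seat gridfusion-model-3 (g10)).  ★ #114 /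
«#114′ UPPER» bracket the twin's clearing time WITHOUT limiter (`0.70 s ≤ CCT(M_twin) ≤ 0.74 s`); the print's
«`t_c = 498` ms with `H_VSC = 5` s» [cite: Qoria2020, §V.3.6, Fig. V-19/V-20] has the virtual impedance active
after clearing and was context only.  THIS FILE puts the VI into the model: post-fault the twin runs on the
MAXIMAL-VI quasi-static curve (V-18) = `pLossy 1 1 R_T″ X_T″` (II-30), i.e. in the shifted angle `δ′ = δ + φ′` the
classical SMIB `gfmQoriaV5sVI = ⟨113/3550, 113/1420, A″ sin δ₁″, 0, A″, 0⟩` of `InverterDroopVIData.lean`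
(`gfmQoriaV5sVI_field_shift`; provenance there: PRINTED Table V-1/II-2, COMPOSED P-INV-9/10, exact circle points),
with the SAME closed-form fault-on arc `X_F(T)` (bolted fault, `p_mes ≡ 0`):
* `twinVI_cct_lower` — every `T ≤ 11/25` s: every post-fault motion WITH THE VI KEPT AT ITS MAXIMUM keeps the
  VI-curve window, `V_VI ≤ 9/20 < V_cr,VI` (`> 0.4808` certified), and tends to the VI rest point `(δ₁″, 0)`
  (`δ₁″ − φ′ = 0.5148` in converter angle) — energy well of the shifted SMIB (`energyWell_roa_Ici`) ∘ the arc;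
  numerals `e^{−11/20} ∈ [0.576949, 0.57695]`, shifted arc angle `∈ [0.2806, 1.3688]`;
* `twinVI_poleSlip_of_clearing_ge` — every `T ≥ 29/50` s: every such motion slips a pole on the VI curve —
  lit-1's excess criterion in threshold form (`excess_mono`, `poleSlip_of_excessEnergy`, `poleSlip_of_beyond_uep`)
  at the corner `(2.0011, 4.8093)`, `e^{−29/40} ∈ [0.48432, 0.484325]`, `V_cr,VI < 0.4811`,
  `V_PE(2.0011) ≥ 0.4007`, allowance `≤ 0.1801`, `m = 1/20`;  `twinVI_cct_bracket` — both sides.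
THREE COLUMNS.  CERTIFIED: «MODEL M_twin+VI (droop GFM ≡ SMIB, MV-6D + MV-P + MV-Ω + P-INV-7/8/9/10; maximal-VI
curve throughout the post-fault motion — no intermediate `Z_VI`, no release): every fault cleared at `T ≤ 0.44` s
relocks on the VI curve, every fault cleared at `T ≥ 0.58` s slips a pole: `0.44 s ≤ CCT ≤ 0.58 s`».  VALIDATED
(floats, never used): RK4 on M_twin+VI puts the model's CCT at `0.517 s` (latched or released); PRINTED `498 ms`
for the same converter (`H = 5 s`, `p* = 0.5`, Table V-1 VI) — inside the bracket, 4 % below the float (print: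
VI dynamics (V-6), TVR, inner loops; here `V_m′`, `R_g` composed).  MODELLED: nothing about a device.
-/

noncomputable section

open Real Set Filter Topology
open Summit.Ventures.GridStability.Models.AngleEnclosure

namespace Summit.Ventures.GridStability.Models.SMIB

open InverterDroop InverterDroop.qoriaV3p08

/-! ## §1 The VI-shifted record: exact facts -/

/-- `sin δ₁″ = 8736/14065`. -/
theorem sin_twinVI_δ1 : sin twinVI_δ1 = twinVI_s1 := by
  unfold twinVI_δ1 twinVI_s1; rw [sin_arcsin] <;> norm_num

/-- `cos δ₁″ = 11023/14065`. -/
theorem cos_twinVI_δ1 : cos twinVI_δ1 = twinVI_c1 := by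
  unfold twinVI_δ1 twinVI_c1
  rw [cos_arcsin, show (1 : ℝ) - (8736 / 14065) ^ 2 = (11023 / 14065) ^ 2 by norm_num, sqrt_sq]
  norm_num

/-- `Z_T″ > 0` and `A″ = 1/Z_T″ > 0`. -/
theorem twinVI_Z_pos : 0 < twinVI_Z ∧ 0 < twinVI_A :=
  have hZ : 0 < twinVI_Z := by unfold twinVI_Z; norm_num
  ⟨hZ, by unfold twinVI_A; exact div_pos one_pos hZ⟩

/-- The record is lossless-reduced in the shifted angle (`γ = 0`, `P_C = 0`). -/
theorem gfmQoriaV5sVI_γ : gfmQoriaV5sVI.γ = 0 := rfl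

/-- lit-2 reading: `⟨113/3550, 113/1420, A″ sin δ₁″, A″⟩`. -/
theorem gfmQoriaV5sVI_toLit :
    gfmQoriaV5sVI.toLit = ⟨113 / 3550, 113 / 1420, twinVI_A * twinVI_s1, twinVI_A⟩ := by
  simp only [toLit, gfmQoriaV5sVI, sub_zero]

/-- `δ₁″` is the equilibrium angle of the VI-shifted record (`A″ sin δ₁″ = P_m`, exact). -/
theorem gfmQoriaV5sVI_isEquilibrium : gfmQoriaV5sVI.IsEquilibrium twinVI_δ1 := by
  rw [isEquilibrium_iff]
  simp only [gfmQoriaV5sVI, sub_zero, sin_twinVI_δ1]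

/-- Certified `0.6701 < δ₁″ < 0.6702` (float `0.6701662`). -/
theorem twinVI_δ1_bounds : (6701 / 10000 : ℝ) < twinVI_δ1 ∧ twinVI_δ1 < 6702 / 10000 := by
  have hc : cos (arcsin (8736 / 14065 : ℝ)) = 11023 / 14065 := cos_twinVI_δ1
  unfold twinVI_δ1
  constructor
  · refine arcsin_gt_of_chain hc (by norm_num) (by linarith [pi_gt_three]) ?_ ?_ ?_ ?_ ?_ <;>
      norm_num [dbl, cosLower4]
  · refine arcsin_lt_of_chain hc (by norm_num) (by linarith [pi_gt_three]) ?_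
    norm_num [dbl, cosUpper4]

/-- `0 < δ₁″ < π/2`. -/
theorem twinVI_δ1_mem : 0 < twinVI_δ1 ∧ twinVI_δ1 < π / 2 := by
  constructor <;> linarith [pi_gt_three, twinVI_δ1_bounds.1, twinVI_δ1_bounds.2]

/-- Certified `0.4808 < V_cr,VI < 0.4811` — the VI curve's energy well is SEVEN per cent of the unlimited one's
(`V_cr = 6.49`): `V_cr,VI = −A″ sin δ₁″ (π − 2δ₁″) + 2A″ cos δ₁″` (float `0.480954`). -/
theorem twinVI_criticalEnergy_bounds :
    (4808 / 10000 : ℝ) < gfmQoriaV5sVI.toLit.criticalEnergy twinVI_δ1 ∧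
      gfmQoriaV5sVI.toLit.criticalEnergy twinVI_δ1 < 4811 / 10000 := by
  rw [Literature.MathematicalPhysics.PowerSystems.SMIB.criticalEnergy, gfmQoriaV5sVI_toLit, cos_twinVI_δ1]
  obtain ⟨h1, h2⟩ := twinVI_δ1_bounds
  have hπ1 := pi_gt_d6
  have hπ2 := pi_lt_d6
  norm_num at hπ1 hπ2
  simp only [twinVI_A, twinVI_Z, twinVI_s1, twinVI_c1]
  constructor
  · norm_num at h1 h2 ⊢; nlinarith
  · norm_num at h1 h2 ⊢; nlinarith

/-- **The twin on its maximal-VI curve IS the shifted SMIB.**  For every state, the VI-shifted record's field at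
`(δ + φ′, ω)` is `(ω, (p*′ − pLossy 1 1 R_T″ X_T″ δ − D ω)/M)` — the twin's post-fault equation with the printed
maximal-VI power map (V-18) = (II-30) (`pLossy_eq_shifted_sin`) and `V_e = V_m′ = 1`; so `X` solves the twin
with VI iff `X + (φ′, 0)` solves `gfmQoriaV5sVI`. [cite: Qoria2020, §V.3.2 (V-18)] -/
theorem gfmQoriaV5sVI_field_shift (δ ω : ℝ) :
    gfmQoriaV5sVI.field (δ + qoriaV3VI_φ, ω) =
      (ω, ((8290560 / 16581121 : ℝ) - pLossy 1 1 twinVI_RT twinVI_XT δ - (113 / 1420) * ω) / (113 / 3550)) := by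
  have hZ := twinVI_Z_pos.1.ne'
  have hR : twinVI_RT = twinVI_Z * sin qoriaV3VI_φ := by rw [sin_φ]; rfl
  have hX : twinVI_XT = twinVI_Z * cos qoriaV3VI_φ := by rw [cos_φ]; rfl
  rw [pLossy_eq_shifted_sin hZ hR hX, sin_φ]
  simp only [field, Pe, gfmQoriaV5sVI, sub_zero, zero_add, Prod.mk.injEq, true_and]
  unfold twinVI_A twinVI_s1 qoriaV3VI_sφ
  unfold twinVI_Z at hZ ⊢
  field_simp
  ring
/-! ## §2 The VI curve's potential along the fault-on arc -/

/-- Left of the rest angle the VI potential DECREASES: `V_PE(δ₁″; ·)` is antitone on `[0, δ₁″]`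
(derivative `−P_m + A″ sin x = A″(sin x − sin δ₁″) ≤ 0`). [folklore] -/
theorem twinVI_potential_antitoneOn :
    AntitoneOn (gfmQoriaV5sVI.toLit.potentialEnergy twinVI_δ1) (Icc 0 twinVI_δ1) := by
  set p := gfmQoriaV5sVI.toLit with hp
  have hδ1 := twinVI_δ1_mem
  apply antitoneOn_of_hasDerivWithinAt_nonpos (convex_Icc _ _)
  · exact fun x _ => (p.hasDerivAt_potentialEnergy twinVI_δ1 x).continuousAt.continuousWithinAt
  · exact fun x _ => (p.hasDerivAt_potentialEnergy twinVI_δ1 x).hasDerivWithinAt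
  · intro x hx
    rw [interior_Icc] at hx
    have hsin : sin x ≤ sin twinVI_δ1 :=
      sin_le_sin_of_le_of_le_pi_div_two (by linarith [pi_pos, hx.1]) hδ1.2.le hx.2.le
    have hA := twinVI_Z_pos.2
    rw [hp, gfmQoriaV5sVI_toLit]
    dsimp only
    rw [← sin_twinVI_δ1]
    nlinarith

/-- **Fault-on angle, shifted, and VI energy at `T ≤ 11/25`.**  For `0 ≤ T ≤ 11/25` the shifted fault-on state
`(δ_F(T) + φ′, Ω_F(T))` has its angle in `[δˢ + φ′, 1.3688] ⊂ (0, π − δ₁″)` and VI energy `≤ 9/20`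
(kinetic `≤ ½M(kpTwin(1 − e^{−11/10}))² ≤ 0.2797`; potential `≤ 0.0698` left of `δ₁″` (antitone from
`δˢ + φ′ ≥ 0.2806`) and `≤ 0.1605` right of it (monotone up to `1.3688`)). -/
theorem twinVI_faultOn_energy_le {T : ℝ} (hT0 : 0 ≤ T) (hT : T ≤ 11 / 25) :
    (2806 / 10000 : ℝ) ≤ (twinFaultOnState T).1 + qoriaV3VI_φ ∧
      (twinFaultOnState T).1 + qoriaV3VI_φ ≤ 13688 / 10000 ∧
      gfmQoriaV5sVI.energy twinVI_δ1 ((twinFaultOnState T).1 + qoriaV3VI_φ, (twinFaultOnState T).2)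
        ≤ 9 / 20 := by
  -- exponential enclosure e^{−11/20}
  have hE : (576949 / 1000000 : ℝ) ≤ exp (-(11 / 20)) ∧ exp (-(11 / 20)) ≤ 11539 / 20000 := by
    have h := Real.exp_bound (x := -(11 / 20 : ℝ)) (by rw [abs_le]; constructor <;> norm_num) (n := 8) (by norm_num)
    simp only [Finset.sum_range_succ, Finset.sum_range_zero, Nat.factorial, Nat.succ_eq_add_one] at h
    norm_num at h
    rw [abs_le] at h
    constructor <;> linarith [h.1, h.2]
  have hE2 : (576949 / 1000000 : ℝ) ^ 2 ≤ exp (-(11 / 10)) ∧ exp (-(11 / 10)) ≤ (11539 / 20000 : ℝ) ^ 2 := by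
    have hsq : exp (-(11 / 10 : ℝ)) = exp (-(11 / 20)) * exp (-(11 / 20)) := by
      rw [← Real.exp_add]; norm_num
    have h0 : 0 ≤ exp (-(11 / 20 : ℝ)) := (exp_pos _).le
    rw [hsq]; constructor <;> nlinarith [hE.1, hE.2]
  have hδs1 := deltaQV4_gt
  have hδs2 := deltaQV4_lt
  obtain ⟨hφ1, hφ2⟩ := φ_bounds
  obtain ⟨hd1, hd2⟩ := twinVI_δ1_bounds
  have hkp : (0 : ℝ) < kpTwin := by norm_num [kpTwin]
  -- the arc bracket is in [0, its value at 11/25]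
  have hbr0 : 0 ≤ T - (1 - exp (-(5 / 2) * T)) / (5 / 2) := by
    have h1 : 1 - exp (-((5 / 2) * T)) ≤ (5 / 2) * T := by
      have := add_one_le_exp (-((5 / 2) * T)); linarith
    rw [show -(5 / 2 : ℝ) * T = -((5 / 2) * T) by ring, sub_nonneg, div_le_iff₀ (by norm_num : (0:ℝ) < 5 / 2)]
    linarith
  have hbr1 : T - (1 - exp (-(5 / 2) * T)) / (5 / 2) ≤ 11 / 25 - (1 - exp (-(5 / 2) * (11 / 25))) / (5 / 2) :=
    faultOn_bracket_mono (by norm_num) hT0 hT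
  have h1125 : exp (-(5 / 2 : ℝ) * (11 / 25)) = exp (-(11 / 10)) := by norm_num
  rw [h1125] at hbr1
  -- angle bounds (shifted)
  have hang_lo : (2806 / 10000 : ℝ) ≤ (twinFaultOnState T).1 + qoriaV3VI_φ := by
    simp only [twinFaultOnState]; nlinarith
  have hang_hi : (twinFaultOnState T).1 + qoriaV3VI_φ ≤ 13688 / 10000 := by
    simp only [twinFaultOnState]
    have : kpTwin * (T - (1 - exp (-(5 / 2) * T)) / (5 / 2))
        ≤ kpTwin * (11 / 25 - (1 - exp (-(11 / 10))) / (5 / 2)) := mul_le_mul_of_nonneg_left hbr1 hkp.le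
    norm_num [kpTwin] at this hδs2 hE2 ⊢
    nlinarith [hE2.2]
  refine ⟨hang_lo, hang_hi, ?_⟩
  -- speed bounds
  have hexpT : exp (-(11 / 10)) ≤ exp (-(5 / 2) * T) := by rw [exp_le_exp]; nlinarith
  have hexpT1 : exp (-(5 / 2) * T) ≤ 1 := by rw [exp_le_one_iff]; nlinarith
  have hΩ0 : 0 ≤ (twinFaultOnState T).2 := by
    simp only [twinFaultOnState]; exact mul_nonneg hkp.le (by linarith)
  have hΩ1 : (twinFaultOnState T).2 ≤ kpTwin * (1 - (576949 / 1000000) ^ 2) := by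
    simp only [twinFaultOnState]; exact mul_le_mul_of_nonneg_left (by linarith [hE2.1]) hkp.le
  have hKE : (113 : ℝ) / 3550 * (twinFaultOnState T).2 ^ 2 / 2 ≤ 2797 / 10000 := by
    have h2 : (twinFaultOnState T).2 ^ 2 ≤ (kpTwin * (1 - (576949 / 1000000) ^ 2)) ^ 2 :=
      pow_le_pow_left₀ hΩ0 hΩ1 2
    norm_num [kpTwin] at h2 ⊢
    nlinarith
  -- potential bound, two sides of the rest angle
  set p := gfmQoriaV5sVI.toLit with hp
  have hpv : p = ⟨113 / 3550, 113 / 1420, twinVI_A * twinVI_s1, twinVI_A⟩ := gfmQoriaV5sVI_toLit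
  set d' := (twinFaultOnState T).1 + qoriaV3VI_φ with hd'
  have hA := twinVI_Z_pos.2
  have hpot : p.potentialEnergy twinVI_δ1 d' ≤ 1605 / 10000 := by
    rcases le_total d' twinVI_δ1 with hle | hge
    · -- left: antitone from 0.2806
      have hanti := twinVI_potential_antitoneOn (show (2806 / 10000 : ℝ) ∈ Icc 0 twinVI_δ1 from
        ⟨by norm_num, by linarith⟩) ⟨by linarith, hle⟩ hang_lo
      rw [← hp] at hanti
      refine hanti.trans ?_
      have hcos : cosLower4 (2808 / 10000) ≤ cos (2808 / 10000 : ℝ) :=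
        cosLower4_le_cos _ (by norm_num [dbl]) (by norm_num [dbl]) (by norm_num [dbl]) (by norm_num [dbl])
      have hcos2 : cos (2808 / 10000 : ℝ) ≤ cos (2806 / 10000 : ℝ) :=
        cos_le_cos_of_nonneg_of_le_pi (by norm_num) (by linarith [pi_gt_three]) (by norm_num)
      rw [hpv]
      unfold Literature.MathematicalPhysics.PowerSystems.SMIB.potentialEnergy
      rw [cos_twinVI_δ1]
      simp only [twinVI_A, twinVI_Z, twinVI_s1, twinVI_c1]
      norm_num [dbl, cosLower4] at hcos hd1 hd2 ⊢
      nlinarith [hcos, hcos2]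
    · -- right: monotone up to 1.3688
      have heq : p.IsEquilibriumAngle twinVI_δ1 :=
        (toLit_isEquilibriumAngle_iff gfmQoriaV5sVI_γ twinVI_δ1).2 gfmQoriaV5sVI_isEquilibrium
      have hmono := p.potentialEnergy_monotoneOn_arc (by rw [hpv]; exact hA.le) heq twinVI_δ1_mem.1.le
        twinVI_δ1_mem.2.le ⟨hge, by linarith [pi_gt_three]⟩
        ⟨by linarith, by linarith [pi_gt_three]⟩ hang_hi
      refine hmono.trans ?_
      have hcos : cosLower4 (13688 / 10000) ≤ cos (13688 / 10000 : ℝ) :=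
        cosLower4_le_cos _ (by norm_num [dbl]) (by norm_num [dbl]) (by norm_num [dbl]) (by norm_num [dbl])
      rw [hpv]
      unfold Literature.MathematicalPhysics.PowerSystems.SMIB.potentialEnergy
      rw [cos_twinVI_δ1]
      simp only [twinVI_A, twinVI_Z, twinVI_s1, twinVI_c1]
      norm_num [dbl, cosLower4] at hcos hd1 hd2 ⊢
      nlinarith [hcos]
  have hE : gfmQoriaV5sVI.energy twinVI_δ1 (d', (twinFaultOnState T).2)
      = (113 : ℝ) / 3550 * (twinFaultOnState T).2 ^ 2 / 2 + p.potentialEnergy twinVI_δ1 d' := by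
    rw [← toLit_energy gfmQoriaV5sVI_γ, ← hp]
    show p.energy twinVI_δ1 (d', (twinFaultOnState T).2) = _
    unfold Literature.MathematicalPhysics.PowerSystems.SMIB.energy
    rw [hpv]
    ring
  rw [hE]
  linarith
/-! ## §3 The bracket -/

/-- **Certified clearing time ≥ 0.44 s for MODEL M_twin+VI (VI at its maximum after clearing).**  For every
fault duration `0 ≤ T ≤ 11/25` s: every solution `Y` of the VI-shifted record on `[0, ∞)` started at the shifted
fault-on state `X_F(T) + (φ′, 0)` keeps `δ + φ′ ∈ (−π − δ₁″, π − δ₁″)` and `V_VI ≤ 9/20` for ever and tends to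
`(δ₁″, 0)` — in converter coordinates the twin with its VI kept at the maximum relocks at the VI-curve rest angle
`δ₁″ − φ′` (energy route ∘ closed-form arc, 0 kit).  MODELLED: M_twin+VI; the release to the unlimited curve is
the companion file's theorem; nothing about a device. [cite: Qoria2020, §V.3.2 (V-18), §V.3.6] -/
theorem twinVI_cct_lower {T : ℝ} (hT0 : 0 ≤ T) (hT : T ≤ 11 / 25) {Y : ℝ → ℝ × ℝ}
    (hY : gfmQoriaV5sVI.IsSolutionOn Y (Ici 0))
    (h0 : Y 0 = ((twinFaultOnState T).1 + qoriaV3VI_φ, (twinFaultOnState T).2)) :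
    (∀ t, 0 ≤ t → (Y t).1 ∈ Ioo (-π - twinVI_δ1) (π - twinVI_δ1) ∧
        gfmQoriaV5sVI.energy twinVI_δ1 (Y t) ≤ 9 / 20) ∧
      Tendsto Y atTop (𝓝 (twinVI_δ1, 0)) := by
  obtain ⟨hlo, hhi, hE⟩ := twinVI_faultOn_energy_le hT0 hT
  have hd := twinVI_δ1_bounds
  refine energyWell_roa_Ici (p := gfmQoriaV5sVI) rfl (by norm_num [gfmQoriaV5sVI])
    (by norm_num [gfmQoriaV5sVI]) (by simp only [gfmQoriaV5sVI]; exact twinVI_Z_pos.2)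
    gfmQoriaV5sVI_isEquilibrium twinVI_δ1_mem.1.le twinVI_δ1_mem.2
    (lt_trans (by norm_num) twinVI_criticalEnergy_bounds.1) hY ?_ ?_
  · rw [h0]
    constructor
    · linarith [pi_pos]
    · linarith [pi_gt_three]
  · rw [h0]; exact hE

set_option maxHeartbeats 400000 in
/-- **Every clearing time `T ≥ 0.58 s` ends in a pole slip for MODEL M_twin+VI.**  For every `T ≥ 29/50` s and
every solution `Y` of the VI-shifted record on `[0, ∞)` from `X_F(T) + (φ′, 0)`: at some `t ≥ 0`,
`(Y t).1 − δ₁″ > π` — the twin with its VI at the maximum slips a pole.  lit-1's excess criterion in threshold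
form: corner `(2.0011, 4.8093)` valid for every `T ≥ 29/50` (monotone arc), `excess_mono` up to the cleared
state or `poleSlip_of_beyond_uep` past `π − δ₁″`; `V_cr,VI < 0.4811`, `V_PE(2.0011) ≥ 0.4007`, allowance
`≤ 0.1801`, `m = 1/20`.  MODELLED: M_twin+VI; nothing about a device.
[cite: SauerPai1998, §9.6.2 (text after (9.36)), §9.6.3 (9.48); Qoria2020, §V.3.6] -/
theorem twinVI_poleSlip_of_clearing_ge {T : ℝ} (hT : 29 / 50 ≤ T) {Y : ℝ → ℝ × ℝ}
    (hY : gfmQoriaV5sVI.IsSolutionOn Y (Ici 0))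
    (h0 : Y 0 = ((twinFaultOnState T).1 + qoriaV3VI_φ, (twinFaultOnState T).2)) :
    ∃ t : ℝ, 0 ≤ t ∧ π < (Y t).1 - twinVI_δ1 := by
  set p := gfmQoriaV5sVI.toLit with hp
  have hpv : p = ⟨113 / 3550, 113 / 1420, twinVI_A * twinVI_s1, twinVI_A⟩ := gfmQoriaV5sVI_toLit
  have hA := twinVI_Z_pos.2
  have hM : 0 < p.M := by rw [hpv]; norm_num
  have hD : 0 ≤ p.D := by rw [hpv]; norm_num
  have hPmax : 0 < p.Pmax := by rw [hpv]; exact hA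
  have heq : p.IsEquilibriumAngle twinVI_δ1 :=
    (toLit_isEquilibriumAngle_iff gfmQoriaV5sVI_γ twinVI_δ1).2 gfmQoriaV5sVI_isEquilibrium
  have hXlit : ∀ S : ℝ, ∀ t ∈ Icc 0 S, HasDerivWithinAt Y (p.vectorField (Y t)) (Icc 0 S) t :=
    fun S => (isSolutionOn_iff_toLit gfmQoriaV5sVI_γ Y _).1 (hY.restrict_Icc S)
  obtain ⟨hd1, hd2⟩ := twinVI_δ1_bounds
  obtain ⟨hφ1, hφ2⟩ := φ_bounds
  have hδs1 := deltaQV4_gt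
  have hπlo := Real.pi_gt_d6
  have hπhi := Real.pi_lt_d6
  have hkp : (0 : ℝ) < kpTwin := by norm_num [kpTwin]
  -- exponential enclosure e^{−29/40} and the corner, valid for every T ≥ 29/50
  have hE : (48432 / 100000 : ℝ) ≤ exp (-(29 / 40)) ∧ exp (-(29 / 40)) ≤ 484325 / 1000000 := by
    have h := Real.exp_bound (x := -(29 / 40 : ℝ)) (by rw [abs_le]; constructor <;> norm_num) (n := 8) (by norm_num)
    simp only [Finset.sum_range_succ, Finset.sum_range_zero, Nat.factorial, Nat.succ_eq_add_one] at h
    norm_num at h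
    rw [abs_le] at h
    constructor <;> linarith [h.1, h.2]
  have hsq : exp (-(29 / 20 : ℝ)) = exp (-(29 / 40)) * exp (-(29 / 40)) := by
    rw [← Real.exp_add]; norm_num
  have h2950 : exp (-(5 / 2 : ℝ) * (29 / 50)) = exp (-(29 / 20)) := by norm_num
  have hexpT : exp (-(5 / 2) * T) ≤ exp (-(29 / 20)) := by rw [exp_le_exp]; nlinarith
  have hbr : (29 : ℝ) / 50 - (1 - exp (-(5 / 2) * (29 / 50))) / (5 / 2) ≤ T - (1 - exp (-(5 / 2) * T)) / (5 / 2) :=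
    faultOn_bracket_mono (by norm_num) (by norm_num) hT
  rw [h2950] at hbr
  have h0e : 0 ≤ exp (-(29 / 40 : ℝ)) := (exp_pos _).le
  have hEhi : exp (-(29 / 20 : ℝ)) ≤ (484325 / 1000000) ^ 2 := by rw [hsq]; nlinarith [hE.2]
  have hElo : (48432 / 100000 : ℝ) ^ 2 ≤ exp (-(29 / 20 : ℝ)) := by rw [hsq]; nlinarith [hE.1]
  have hωlo : (48093 / 10000 : ℝ) ≤ (twinFaultOnState T).2 := by
    have hc : (48093 / 10000 : ℝ) ≤ kpTwin * (1 - exp (-(29 / 20))) := by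
      norm_num [kpTwin] at hEhi ⊢; nlinarith [hEhi]
    have hm : kpTwin * (1 - exp (-(29 / 20))) ≤ kpTwin * (1 - exp (-(5 / 2) * T)) :=
      mul_le_mul_of_nonneg_left (by linarith [hexpT]) hkp.le
    simp only [twinFaultOnState]
    exact hc.trans hm
  have hδlo : (20011 / 10000 : ℝ) ≤ (twinFaultOnState T).1 + qoriaV3VI_φ := by
    have hc : (20011 / 10000 : ℝ) ≤ 1253 / 10000 + 1553 / 10000 +
        kpTwin * (29 / 50 - (1 - exp (-(29 / 20))) / (5 / 2)) := by
      norm_num [kpTwin] at hElo ⊢; nlinarith [hElo]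
    have hm : kpTwin * (29 / 50 - (1 - exp (-(29 / 20))) / (5 / 2)) ≤
        kpTwin * (T - (1 - exp (-(5 / 2) * T)) / (5 / 2)) :=
      mul_le_mul_of_nonneg_left hbr hkp.le
    simp only [twinFaultOnState]
    linarith
  -- the cleared state
  have hωc : 0 < (Y 0).2 := by rw [h0]; exact lt_of_lt_of_le (by norm_num) hωlo
  have hY1 : (Y 0).1 = (twinFaultOnState T).1 + qoriaV3VI_φ := by rw [h0]
  have hY2 : (Y 0).2 = (twinFaultOnState T).2 := by rw [h0]
  -- corner facts
  have hVcr := twinVI_criticalEnergy_bounds.2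
  rw [← hp] at hVcr
  have hDM : p.D / p.M = 5 / 2 := by rw [hpv]; norm_num
  have hωlo_D : p.D / p.M * (π - twinVI_δ1 - 20011 / 10000) ≤ 48093 / 10000 := by
    rw [hDM]; norm_num at hπhi hd1 ⊢; nlinarith
  have hcos : cos (20011 / 10000 : ℝ) ≤ cosUpper4 (20011 / 10000) :=
    cos_le_cosUpper4 (by norm_num) (by linarith [pi_gt_three])
  have hPE : (4007 / 10000 : ℝ) ≤ p.potentialEnergy twinVI_δ1 (20011 / 10000) := by
    rw [hpv]
    unfold Literature.MathematicalPhysics.PowerSystems.SMIB.potentialEnergy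
    rw [cos_twinVI_δ1]
    simp only [twinVI_A, twinVI_Z, twinVI_s1, twinVI_c1]
    norm_num [dbl, cosUpper4] at hcos hd1 hd2 ⊢
    nlinarith
  have hKE : (1 : ℝ) / 2 * p.M * (48093 / 10000) ^ 2 = 261361841337 / 710000000000 := by
    rw [hpv]; norm_num
  have hallow : p.D * (48093 / 10000) * (π - twinVI_δ1 - 20011 / 10000) ≤ 1801 / 10000 := by
    rw [hpv]; norm_num at hπhi hd1 ⊢; nlinarith
  have hexcess0 : p.criticalEnergy twinVI_δ1 + 1 / 20 + p.D * (48093 / 10000) * (π - twinVI_δ1 - 20011 / 10000)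
      ≤ p.energy twinVI_δ1 (20011 / 10000, 48093 / 10000) := by
    have hE : p.energy twinVI_δ1 (20011 / 10000, 48093 / 10000)
        = 1 / 2 * p.M * (48093 / 10000) ^ 2 + p.potentialEnergy twinVI_δ1 (20011 / 10000) := rfl
    rw [hE, hKE]
    norm_num at hVcr hPE hallow ⊢
    linarith
  -- two regimes of the cleared angle
  by_cases hbeyond : π - twinVI_δ1 < (Y 0).1
  · exact p.poleSlip_of_beyond_uep hM hD hPmax heq twinVI_δ1_mem.2.le hXlit hbeyond hωc
  push Not at hbeyond
  rw [hY1] at hbeyond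
  have hmono := p.excess_mono hM hD hPmax.le heq twinVI_δ1_mem.1.le twinVI_δ1_mem.2.le
    (δ₁ := 20011 / 10000) (δ₂ := (twinFaultOnState T).1 + qoriaV3VI_φ) (ω₁ := 48093 / 10000)
    (ω₂ := (twinFaultOnState T).2) (by norm_num at hd2 ⊢; linarith) hδlo hbeyond hωlo hωlo_D
  have hexcess : p.criticalEnergy twinVI_δ1 + 1 / 20 +
      p.D * (Y 0).2 * (π - twinVI_δ1 - (Y 0).1) ≤ p.energy twinVI_δ1 (Y 0) := by
    rw [h0]
    dsimp only
    linarith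
  exact p.poleSlip_of_excessEnergy hM hD hPmax heq twinVI_δ1_mem.1.le twinVI_δ1_mem.2 hXlit
    (by rw [hY1]; norm_num at hd2 ⊢; linarith) (by rw [hY1]; exact hbeyond) hωc
    (by norm_num : (0 : ℝ) < 1 / 20) hexcess

/-- **The clearing-time BRACKET of MODEL M_twin+VI: `0.44 s ≤ CCT ≤ 0.58 s`** (VI at its maximum after
clearing): (i) every `T ∈ [0, 11/25]`: relock on the VI curve (window + `V_VI ≤ 9/20` for ever,
`Y → (δ₁″, 0)`); (ii) every `T ≥ 29/50`: a pole slip, so the window clause of (i) fails.  CERTIFIED for MODEL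
M_twin+VI; VALIDATED RK4 `0.517 s`, PRINTED `498 ms` [cite: Qoria2020, §V.3.6] (like-for-like up to MV:
VI dynamics/TVR/inner loops absent, `V_m′`, `R_g` composed); nothing about a device. -/
theorem twinVI_cct_bracket :
    (∀ T : ℝ, 0 ≤ T → T ≤ 11 / 25 → ∀ Y : ℝ → ℝ × ℝ, gfmQoriaV5sVI.IsSolutionOn Y (Ici 0) →
        Y 0 = ((twinFaultOnState T).1 + qoriaV3VI_φ, (twinFaultOnState T).2) →
        (∀ t, 0 ≤ t → (Y t).1 ∈ Ioo (-π - twinVI_δ1) (π - twinVI_δ1) ∧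
            gfmQoriaV5sVI.energy twinVI_δ1 (Y t) ≤ 9 / 20) ∧
          Tendsto Y atTop (𝓝 (twinVI_δ1, 0))) ∧
    (∀ T : ℝ, 29 / 50 ≤ T → ∀ Y : ℝ → ℝ × ℝ, gfmQoriaV5sVI.IsSolutionOn Y (Ici 0) →
        Y 0 = ((twinFaultOnState T).1 + qoriaV3VI_φ, (twinFaultOnState T).2) →
        (∃ t : ℝ, 0 ≤ t ∧ π < (Y t).1 - twinVI_δ1) ∧
          ¬ (∀ t, 0 ≤ t → (Y t).1 ∈ Ioo (-π - twinVI_δ1) (π - twinVI_δ1))) := by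
  refine ⟨fun T hT0 hT Y hY h0 => twinVI_cct_lower hT0 hT hY h0, fun T hT Y hY h0 => ?_⟩
  obtain ⟨t, ht, hslip⟩ := twinVI_poleSlip_of_clearing_ge hT hY h0
  refine ⟨⟨t, ht, hslip⟩, fun hwin => ?_⟩
  have h := (hwin t ht).2
  linarith [twinVI_δ1_mem.1]

end Summit.Ventures.GridStability.Models.SMIB

end
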